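import Summits.FinalStateConjecture.FinalStateConjecture.Theses.DissipativeFinalMotions
import Summits.FinalStateConjecture.FinalStateConjecture.Theorems.DissipativeFinalMotionsDispersingCaptureStubCaptureOfSettledOn
import Literature.Geometry.Lorentzian.FinalEraRestFrameSettling
import HarnessLib

/-!
# OPTION C for the rev-4 repair of crux stmt-FinalStateConjecture-17643 `DispersingCapture` — lead prover c6, 2026-08-17
# (crux workfile `OptionC_c6.lean`; complements `Restatement_c4.lean` options A/B)

Options A/B (c3/c4) add the Statement-shaped settled data `IsRestFrameSettledOn` (incl. its exhaustion clause
(S6)) to the crux as a HYPOTHESIS, after which the crux is the landed C′ by `exact`. Option C instead adds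
two PRIMITIVE chart-normalisation clauses on the package's own charts, from which (this seat's sixth audit,
`Lines/registered-dead-c6.md` §2) the settled data — exhaustion included — become DERIVABLE from the
package's (EX), (X3), (X4b), (H3), (F), (F₀) by `J⁻`-monotonicity plus ONE certified causal leg (a hover at
constant Kerr–Schild radius `≥ 100 Mᵢ`, where the tree's cone algebra `kerrBilin_ofTimeSpace_one_le` /
`segment_mem_causalFuture` of `Literature.Geometry.Lorentzian.BoostedKerrCausalLegs` applies):

* (NDF) NO DEEP FLAT POINTS: a point charted both by the flat chart and by hole chart `i` (hole time `> T`)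
  has Kerr–Schild radius `≥ 100 Mᵢ` — the radiation chart never reaches the collar / ergoregion of a hole;
* (NL) NO HOLE-CLOCK LEAD ON BOUNDED ZONES: for every radius `R'`, eventually in hole time, a doubly charted
  point of hole radius `≤ R'` has hole time `≤` flat time.

Both are NORMALISATIONS satisfied by the intended eras (honest flat domain `{dist > ρ₀}` with
`ρ₀ ≥ 100 max Mᵢ + |aᵢ| + C₁`; for a hole moving with lab velocity `v ≠ 0` the flat clock leads by
`(γ − 1) t*` on bounded zones, for `v = 0` shift the hole clock by `+1`), unlike exact synchronisation
(dishonest for moving rest-frame charts under (H2′)). The two gap configurations of the six audits are exactly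
their negations: c4's family (hole-clock lead `L(s) ↑ ∞` on the band) violates (NL); c5's conveyor / deep
fingers and c1/c2's collar points violate (NDF).

Contents: `DispersingCapture₇` (pasteable signature: rev 3 + (NDF) + (NL) + escape rates), the BRIDGE
statement `SettledOfNormalised` (package + (NDF) + (NL) + (F) + (F₀) + dispersal ⇒ `∃ T₁ ρ R U₁ Φ₀,
IsRestFrameSettledOn …`; to be PROVED by this line as registered stub work, see the reshaped skeleton), and
the kernel-checked composition `dispersingCapture₇_of_bridge : SettledOfNormalised → DispersingCapture₇`
(via the landed C′ `stub_captureOfSettledOn`, p155631). Under option A the bridge is the lemma a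
`FinalEraGeneric₆` prover needs to discharge `IsRestFrameSettledOn` from primitive chart data.
-/

set_option linter.dupNamespace false

noncomputable section

namespace Summit.FinalStateConjecture.FinalStateConjecture.Cruxes.DispersingCapture.OptionC

-- the SAME `open`s as the route file `Theses/DissipativeFinalMotions.lean` (pasteability of the bodies below)
open scoped BigOperators Topology Manifold Classical MeasureTheory ProbabilityTheory Matrix InnerProductSpace ComplexConjugate ContinuousMap
open Filter Set Function TopologicalSpace MeasureTheory

open Summit.FinalStateConjecture.FinalStateConjecture.Theorems.DissipativeFinalMotions.DispersingCapture
  (stub_captureOfSettledOn)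

/-- **PROPOSED `DispersingCapture` rev 4, option C** (pasteable signature): rev 3 with the two
normalisation clauses (NDF), (NL) inserted after the package, and the integrable escape rates as last
hypothesis (as in option A; drop it for the bare form closed modulo E, or replace it by Cesàro velocities as
in option B). -/
def DispersingCapture₇ : Prop :=
  ∀ (X : Type) [TopologicalSpace X] [ChartedSpace (EuclideanSpace ℝ (Fin 3)) X] [IsManifold (𝓡 3) ((⊤ : ℕ∞) : WithTop ℕ∞) X] [T2Space X] [SecondCountableTopology X] [ConnectedSpace X], ∀ (D : Literature.Geometry.Lorentzian.InitialDataSet (𝓡 3) X), D ∈ Literature.Geometry.Lorentzian.admissibleVacuumData X → ∀ (𝒟 : Literature.Geometry.Lorentzian.VacuumCauchyDevelopment D), 𝒟.IsMaximal → Summit.FinalStateConjecture.HasCompleteNullInfinity 𝒟.toCauchyDevelopment → ∀ (N : ℕ) (M a : Fin N → ℝ) (T δ V C₁ C₂ ρ₀ κ : ℝ) (ξ : Fin N → ℝ → EuclideanSpace ℝ (Fin 3)) (β : ℝ → ℝ) (U₀ : Opens Literature.Geometry.Lorentzian.E4) (B₀ : Literature.Geometry.Lorentzian.ModelBackground) (B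 : Fin N → Literature.Geometry.Lorentzian.ModelBackground) (Ψ₀ : B₀.domain → 𝒟.carrier) (Ψ : (i : Fin N) → (B i).domain → 𝒟.carrier) (O : Set 𝒟.carrier), 𝒟.toCauchyDevelopment.IsFinalEra₂ N M a T δ V C₁ C₂ ρ₀ κ ξ β U₀ B₀ B Ψ₀ Ψ O → (∀ i (x : (B i).domain) (y : B₀.domain), T < x.1 0 → Ψ i x = Ψ₀ y → 100 * M i ≤ (B i).radius x.1) → (∀ i (R' : ℝ), ∃ T₄ : ℝ, ∀ (x : (B i).domain) (y : B₀.domain), T₄ ≤ x.1 0 → (B i).radius x.1 ≤ R' → Ψ i x = Ψ₀ y → x.1 0 ≤ y.1 0) → Summit.FinalStateConjecture.RaysStayInClosure 𝒟.toCauchyDevelopment O → (∀ i (ρ : ℝ), ∀ᶠ τ in atTop, ∀ x ∈ (B i).truncTimeSlab ρ τ, 𝒟.toSpacetime.timeOrientation.IsFutureDirected (mfderiv 𝓘(ℝ, Literature.Geometry.Lorentzian.E4) (𝓡 4) (Ψ i) x (Literature.Geometry.Lorentzian.Kerr.timeVector (M i) (a i) x.1))) → (∃ ϱ₀ : ℝ,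 ∀ᶠ τ in atTop, ∀ x ∈ B₀.timeSlab τ, (∀ i, ϱ₀ ≤ ‖Literature.Geometry.Lorentzian.E4.spatial x.1 - ξ i τ‖) → 𝒟.toSpacetime.timeOrientation.IsFutureDirected (mfderiv 𝓘(ℝ, Literature.Geometry.Lorentzian.E4) (𝓡 4) Ψ₀ x (Literature.Geometry.Lorentzian.E4.basisVector 0))) → (∀ i j, i ≠ j → Tendsto (fun t ↦ ‖ξ i t - ξ j t‖) atTop atTop) → (∀ i j, i ≠ j → IntegrableOn (fun t ↦ 1 / ‖ξ i t - ξ j t‖ ^ 2) (Ici T)) → ∃ (O' : Set 𝒟.carrier) (d : Literature.Geometry.Lorentzian.FinalStateDecomposition 𝒟.toSpacetime O' 2), (∀ i, Literature.Geometry.Lorentzian.Kerr.IsSubextremal (d.mass i) (d.spin i)) ∧ O' = Summit.FinalStateConjecture.exteriorOf 𝒟.toCauchyDevelopment d.charted ∧ Summit.FinalStateConjecture.RaysStayInClosure 𝒟.toCauchyDevelopment O' ∧ Summit.FinalStateConjecture.HasExhaustiveCharts d ∧ Summit.FinalStateConjecture.IsFutureOriented d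

/-- **THE BRIDGE** (statement; the line's new registered work): a rev-2 final era whose charts satisfy
(NDF) and (NL), oriented ((F), (F₀)) and pairwise dispersing, settles in its own rest frames in the
Statement's shape — `∃ T₁ ρ R U₁ Φ₀, IsRestFrameSettledOn N M a T₁ ξ B Ψ O U₁ Φ₀ ρ R` (Literature, p154854).
Intended proof (registered-dead-c6.md §2): honest radii by the diagonal lemma on (H3) + dispersal; a
step-thinned flat domain `U₁ = U₀ ∩ ⋃ₘ {tₘ < t < tₘ₊₂, distᵢ > ρₘ ∀ i}` with the steps placed after the
(F3)/(X3)/(X4b)/(H3)/(F)/(NL)/radius thresholds; `Φ₀ = Ψ₀|U₁`; (S6) and (O1) from (EX) at the same level by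
`J⁻`-monotonicity, (X3) for band points, (NL) for the sign of the clock skew, and the certified hover
`s ↦ Ψᵢ(x + s e₀)` at radius `∈ [100 Mᵢ, C₂ρₘ + C₁]` under `C⁰`-deviation `≤ 1/20` (tree:
`kerrBilin_ofTimeSpace_one_le`, `segment_mem_causalFuture`, `isFutureDirected_iff_val_neg`). -/
def SettledOfNormalised : Prop :=
  ∀ (X : Type) [TopologicalSpace X] [ChartedSpace (EuclideanSpace ℝ (Fin 3)) X] [IsManifold (𝓡 3) ((⊤ : ℕ∞) : WithTop ℕ∞) X] [T2Space X] [SecondCountableTopology X] [ConnectedSpace X], ∀ (D : Literature.Geometry.Lorentzian.InitialDataSet (𝓡 3) X) (𝒟 : Literature.Geometry.Lorentzian.VacuumCauchyDevelopment D) (N : ℕ) (M a : Fin N → ℝ) (T δ V C₁ C₂ ρ₀ κ : ℝ) (ξ : Fin N → ℝ → EuclideanSpace ℝ (Fin 3)) (β : ℝ → ℝ) (U₀ : Opens Literature.Geometry.Lorentzian.E4) (B₀ : Literature.Geometry.Lorentzian.ModelBackground) (B : Fin N → Literature.Geometry.Lorentzian.ModelBackground) (Ψ₀ : B₀.domain →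 𝒟.carrier) (Ψ : (i : Fin N) → (B i).domain → 𝒟.carrier) (O : Set 𝒟.carrier), 𝒟.toCauchyDevelopment.IsFinalEra₂ N M a T δ V C₁ C₂ ρ₀ κ ξ β U₀ B₀ B Ψ₀ Ψ O → (∀ i (x : (B i).domain) (y : B₀.domain), T < x.1 0 → Ψ i x = Ψ₀ y → 100 * M i ≤ (B i).radius x.1) → (∀ i (R' : ℝ), ∃ T₄ : ℝ, ∀ (x : (B i).domain) (y : B₀.domain), T₄ ≤ x.1 0 → (B i).radius x.1 ≤ R' → Ψ i x = Ψ₀ y → x.1 0 ≤ y.1 0) → (∀ i (ρ : ℝ), ∀ᶠ τ in atTop, ∀ x ∈ (B i).truncTimeSlab ρ τ, 𝒟.toSpacetime.timeOrientation.IsFutureDirected (mfderiv 𝓘(ℝ, Literature.Geometry.Lorentzian.E4) (𝓡 4) (Ψ i) x (Literature.Geometry.Lorentzian.Kerr.timeVector (M i) (a i) x.1))) → (∃ ϱ₀ : ℝ, ∀ᶠ τ in atTop, ∀ x ∈ B₀.timeSlab τ, (∀ i, ϱ₀ ≤ ‖Literature.Geometry.Lorentzian.E4.spatial x.1 - ξ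 i τ‖) → 𝒟.toSpacetime.timeOrientation.IsFutureDirected (mfderiv 𝓘(ℝ, Literature.Geometry.Lorentzian.E4) (𝓡 4) Ψ₀ x (Literature.Geometry.Lorentzian.E4.basisVector 0))) → (∀ i j, i ≠ j → Tendsto (fun t ↦ ‖ξ i t - ξ j t‖) atTop atTop) → ∃ (T₁ : ℝ) (ρ : ℝ → ℝ) (R : Fin N → ℝ → ℝ) (U₁ : Opens Literature.Geometry.Lorentzian.E4) (Φ₀ : (Literature.Geometry.Lorentzian.Minkowski.backgroundOn U₁).domain → 𝒟.carrier), 𝒟.toCauchyDevelopment.IsRestFrameSettledOn N M a T₁ ξ B Ψ O U₁ Φ₀ ρ R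

/-- **Option C closes by the bridge** (kernel-checked composition through the landed C′, p155631). -/
theorem dispersingCapture₇_of_bridge (hB : SettledOfNormalised) : DispersingCapture₇ := by
  intro X _ _ _ _ _ _ D _hD 𝒟 _hmax _hscri N M a T δ V C₁ C₂ ρ₀ κ ξ β U₀ B₀ B Ψ₀ Ψ O hera hndf hnl hrays
    hholes hflat hdisp hesc
  obtain ⟨T₁, ρ, R, U₁, Φ₀, hset⟩ :=
    hB X D 𝒟 N M a T δ V C₁ C₂ ρ₀ κ ξ β U₀ B₀ B Ψ₀ Ψ O hera hndf hnl hholes hflat hdisp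
  exact stub_captureOfSettledOn X D 𝒟 N M a T δ V C₁ C₂ ρ₀ κ ξ β U₀ B₀ B Ψ₀ Ψ O T₁ ρ R U₁ Φ₀ hera hset hrays
    hholes hdisp hesc

end Summit.FinalStateConjecture.FinalStateConjecture.Cruxes.DispersingCapture.OptionC

end
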